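import Summits.AtomisticToContinuum.HydrodynamicLimit.Theorems.JParityClosureLocalSecondLawLedgerDefs
import Literature.MathematicalPhysics.KineticTheory.HardSphereUniformGas
import Literature.MathematicalPhysics.KineticTheory.HardSphereCanonicalTorus
import Mathlib.MeasureTheory.Measure.Haar.Unique

/-!
# The uniform one-particle marginal of the homogeneous local Gibbs law (lead c3)

Equilibrium side-composition of line `exact-entropy-ledger-three-passivities` for the crux `JParityClosure.LocalSecondLaw`
(stmt-AtomisticToContinuum-13081): the input `eq_uniformMarginal` of the cold-ball stub, proved here in the flow/law vocabulary of
the frame WITHOUT the equilibrium vocabulary module (stated for `localGibbsLaw σ (fun _ => a) (fun _ => ū) (fun _ => Θ) N Φ`, of which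
`lawC` is the `abbrev`).  Proof: rung-0 disintegration onto the positions (`localGibbsMeasure_rung0_eq_map`); the configurational
Gibbs measure at constant activity is invariant under simultaneous translation of all positions (the hard-core weight depends on
differences only, the product Haar measure is invariant: `map_shiftAll_posGibbsMeasure`); hence each one-particle marginal is a
translation-invariant probability measure on the compact torus, i.e. the normalised Haar measure `volume`
(`isAddHaarMeasure_of_isCompact_nonempty_interior`, `addHaarMeasure_unique`).  Helpers live in the sub-namespace `Marginal`; translation invariance of the torus distance is `euclidDist_add_left` (HardSphereCanonicalTorus).

References: H. Spohn, *Large Scale Dynamics of Interacting Particles* (1991), Part I §2.1–2.3 (canonical hard-sphere Gibbs measure,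
translation invariance); A. Weil / Mathlib `MeasureTheory.Measure.Haar.Unique` (uniqueness of Haar measure).
-/

noncomputable section

namespace Summit.AtomisticToContinuum.HydrodynamicLimit.Theorems.LocalSecondLawEquilibrium

open scoped BigOperators Topology Classical MeasureTheory ENNReal InnerProductSpace
open Filter Set MeasureTheory
open Literature.MathematicalPhysics.KineticTheory
open Literature.Analysis.FluidPDE
open Summit.AtomisticToContinuum.HydrodynamicLimit.Theorems.LocalSecondLawNegative
open Summit.AtomisticToContinuum.HydrodynamicLimit.Theorems.LocalSecondLawLedger

namespace Marginal

variable {N : ℕ}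

/-- The simultaneous translation of all positions `xs ↦ (v + xs i)ᵢ` is measurable. -/
theorem measurable_shiftAll (n : ℕ) (v : T3) : Measurable fun (xs : Fin n → T3) (i : Fin n) => v + xs i := by
  refine measurable_pi_lambda _ fun i => ?_
  exact (measurable_const_add v).comp (measurable_pi_apply i)

/-- The simultaneous translation preserves the product Haar measure of the configuration torus. -/
theorem measurePreserving_shiftAll (n : ℕ) (v : T3) :
    MeasurePreserving (fun (xs : Fin n → T3) (i : Fin n) => v + xs i) (volume : Measure (Fin n → T3)) volume := by
  rw [volume_pi]
  exact measurePreserving_pi _ _ fun _ => measurePreserving_add_left volume v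

/-- The hard-core constraint is translation invariant. -/
theorem shiftAll_mem_posDomain_iff (n : ℕ) (ε : ℝ) (v : T3) (xs : Fin n → T3) :
    (fun i => v + xs i) ∈ posDomain ε n ↔ xs ∈ posDomain ε n := by
  simp only [posDomain, Set.mem_setOf_eq, euclidDist_add_left]

/-- For a constant activity the position weight is translation invariant. -/
theorem posWeight_shiftAll (a ε : ℝ) (n : ℕ) (v : T3) (xs : Fin n → T3) :
    posWeight (fun _ : T3 => a) ε n (fun i => v + xs i) = posWeight (fun _ : T3 => a) ε n xs := by
  unfold posWeight
  by_cases h : xs ∈ posDomain ε n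
  · rw [Set.indicator_of_mem h, Set.indicator_of_mem ((shiftAll_mem_posDomain_iff n ε v xs).2 h)]
  · rw [Set.indicator_of_notMem h, Set.indicator_of_notMem (fun h' => h ((shiftAll_mem_posDomain_iff n ε v xs).1 h'))]

/-- **The configurational Gibbs measure at constant activity is invariant under simultaneous translations.** -/
theorem map_shiftAll_posGibbsMeasure (a ε : ℝ) (n : ℕ) (v : T3) :
    (posGibbsMeasure (fun _ : T3 => a) ε n).map (fun (xs : Fin n → T3) (i : Fin n) => v + xs i) =
      posGibbsMeasure (fun _ : T3 => a) ε n := by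
  have hT := measurePreserving_shiftAll n v
  have hρ : Measurable fun xs : Fin n → T3 =>
      ENNReal.ofReal ((posPartition (fun _ : T3 => a) ε n)⁻¹ * posWeight (fun _ : T3 => a) ε n xs) :=
    (measurable_const.mul (measurable_posWeight continuous_const _ _)).ennreal_ofReal
  refine Measure.ext fun A hA => ?_
  rw [Measure.map_apply (measurable_shiftAll n v) hA, posGibbsMeasure,
    withDensity_apply _ ((measurable_shiftAll n v) hA), withDensity_apply _ hA]
  have h1 : ∫⁻ xs in (fun (xs : Fin n → T3) (i : Fin n) => v + xs i) ⁻¹' A,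
      ENNReal.ofReal ((posPartition (fun _ : T3 => a) ε n)⁻¹ * posWeight (fun _ : T3 => a) ε n xs) ∂volume =
      ∫⁻ xs in (fun (xs : Fin n → T3) (i : Fin n) => v + xs i) ⁻¹' A,
        ENNReal.ofReal ((posPartition (fun _ : T3 => a) ε n)⁻¹ * posWeight (fun _ : T3 => a) ε n (fun i => v + xs i))
          ∂volume := by
    refine setLIntegral_congr_fun ((measurable_shiftAll n v) hA) fun xs _ => ?_
    rw [posWeight_shiftAll]
  rw [h1]
  exact hT.setLIntegral_comp_preimage hA hρ

/-- **The one-particle marginal is translation invariant.** -/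
theorem isAddLeftInvariant_marginal (a ε : ℝ) (n : ℕ) (i : Fin n) :
    ((posGibbsMeasure (fun _ : T3 => a) ε n).map fun xs => xs i).IsAddLeftInvariant := by
  refine ⟨fun v => ?_⟩
  rw [Measure.map_map (measurable_const_add v) (measurable_pi_apply i)]
  have hcomp : ((fun x : T3 => v + x) ∘ fun xs : Fin n → T3 => xs i) =
      (fun xs : Fin n → T3 => xs i) ∘ fun (xs : Fin n → T3) (i : Fin n) => v + xs i := by
    funext xs; rfl
  rw [hcomp, ← Measure.map_map (measurable_pi_apply i) (measurable_shiftAll n v), map_shiftAll_posGibbsMeasure]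

/-- **The one-particle marginal of the configurational Gibbs measure at constant activity is Haar**: for `σ ≤ 1/2` and
`a > 0`, `(x ↦ x_i)_* Pos = vol` on `𝕋³` (an invariant probability measure on a compact group is the normalised Haar measure). -/
theorem marginal_eq_volume {a σ : ℝ} (ha : 0 < a) (hσhalf : σ ≤ 1 / 2) (N : ℕ) (i : Fin (N + 1)) :
    (posGibbsMeasure (fun _ : T3 => a) (hsDiameter σ N) (N + 1)).map (fun xs => xs i) = volume := by
  set μ : Measure T3 := (posGibbsMeasure (fun _ : T3 => a) (hsDiameter σ N) (N + 1)).map (fun xs => xs i) with hμ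
  haveI : IsProbabilityMeasure (posGibbsMeasure (fun _ : T3 => a) (hsDiameter σ N) (N + 1)) :=
    isProbabilityMeasure_posGibbsMeasure continuous_const (fun _ => ha) hσhalf N
  haveI hprob : IsProbabilityMeasure μ := Measure.isProbabilityMeasure_map (measurable_pi_apply i).aemeasurable
  haveI : μ.IsAddLeftInvariant := isAddLeftInvariant_marginal a (hsDiameter σ N) (N + 1) i
  haveI : μ.IsAddHaarMeasure :=
    Measure.isAddHaarMeasure_of_isCompact_nonempty_interior _ Set.univ isCompact_univ (by simp)
      (by simp [measure_univ]) (measure_ne_top _ _)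
  have h1 := Measure.addHaarMeasure_unique μ ⊤
  have h2 := Measure.addHaarMeasure_unique (volume : Measure T3) ⊤
  rw [h1, h2, TopologicalSpace.PositiveCompacts.coe_top, measure_univ, measure_univ]

end Marginal

/-- **The one-particle position marginal of the homogeneous local Gibbs law is uniform** (the content of the registered
equilibrium stub `eq_uniformMarginal`, stated for the unfolded homogeneous law): for every Borel `f : 𝕋³ → [0, ∞]`,
`E[∑ᵢ f(xᵢ)] = (N+1) ∫ f` (rung-0 disintegration, translation invariance of the hard-core Gibbs weight, Haar uniqueness on the
compact torus). -/
theorem uniformMarginal_localGibbsLaw_const : ∀ (a Θ σ : ℝ) (ū : V3), 0 < a → 0 < Θ → 0 < σ → σ ≤ 1 / 2 → ∀ (N : ℕ) (Φ : Flow σ N) (f : T3 → ℝ≥0∞), Measurable f → ∫⁻ z, ∑ i : Fin (N + 1), f (z i).1 ∂(localGibbsLaw σ (fun _ => a) (fun _ => ū) (fun _ => Θ) N Φ) = ((N + 1 : ℕ) : ℝ≥0∞) * ∫⁻ y : T3, f y := by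
  intro a Θ σ ū ha hΘ _hσ hσhalf N Φ f hf
  -- rung-0 disintegration onto the positions
  have hg : Measurable fun xs : Fin (N + 1) → T3 => ∑ i : Fin (N + 1), f (xs i) :=
    Finset.measurable_sum _ fun i _ => hf.comp (measurable_pi_apply i)
  have hF : Measurable fun w : Phase N => ∑ i : Fin (N + 1), f (w i).1 :=
    Finset.measurable_sum _ fun i _ => hf.comp (measurable_pi_apply i).fst
  have hpos : ∫⁻ z, ∑ i : Fin (N + 1), f (z i).1 ∂(localGibbsLaw σ (fun _ => a) (fun _ => ū) (fun _ => Θ) N Φ) =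
      ∫⁻ xs, ∑ i : Fin (N + 1), f (xs i) ∂(posGibbsMeasure (fun _ : T3 => a) (hsDiameter σ N) (N + 1)) := by
    rw [localGibbsLaw_eq, localGibbsMeasure_rung0_eq_map σ ha.le hΘ ū N, lintegral_map hF measurable_zipConfig,
      lintegral_prod (fun p => ∑ i : Fin (N + 1), f ((zipConfig p) i).1) (hF.comp measurable_zipConfig).aemeasurable]
    refine lintegral_congr fun xs => ?_
    have : (fun vs : Fin (N + 1) → V3 => ∑ i : Fin (N + 1), f ((zipConfig (xs, vs)) i).1) = fun _ => ∑ i, f (xs i) := by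
      funext vs; rfl
    rw [this, lintegral_const, measure_univ, mul_one]
  have hmeas : ∀ i : Fin (N + 1), Measurable fun xs : Fin (N + 1) → T3 => f (xs i) :=
    fun i => hf.comp (measurable_pi_apply i)
  rw [hpos, lintegral_finsetSum Finset.univ (fun i _ => hmeas i)]
  have hterm : ∀ i : Fin (N + 1), ∫⁻ xs, f (xs i) ∂(posGibbsMeasure (fun _ : T3 => a) (hsDiameter σ N) (N + 1)) =
      ∫⁻ y, f y := by
    intro i
    rw [← Marginal.marginal_eq_volume ha hσhalf N i, lintegral_map hf (measurable_pi_apply i)]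
  simp only [hterm, Finset.sum_const, Finset.card_univ, Fintype.card_fin, nsmul_eq_mul]

end Summit.AtomisticToContinuum.HydrodynamicLimit.Theorems.LocalSecondLawEquilibrium

end
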